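import Literature.Barriers.MatrixMultiplication.YoungSubgroupBarrier
import Literature.Barriers.MatrixMultiplication.YoungSubgroupCounting
import Literature.RepresentationTheory.FiniteGroups.IrreducibleCharacters
import Literature.RepresentationTheory.FiniteGroups.NumberOfIrreducibles
import HarnessLib

/-!
# Proof of the Young-subgroup barrier (Blasiak–Church–Cohn–Grochow–Umans 2017, Prop. 2.4 and Thm. 4.2)

Topic `Literature/Barriers/MatrixMultiplication`; discharges the catalogue entry
`YoungSubgroupBarrier = BCCGU2017_prop24 ∧ BCCGU2017_thm42` of `YoungSubgroupBarrier.lean`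
(statements unchanged):

* `BCCGU2017_prop24_holds` — **Prop. 2.4** (the conjugacy-class criterion), proved as printed
  ("the number of inequivalent irreducible representations of `G` is equal to the number `k` of
  conjugacy classes of `G`. Since `∑ᵢ dᵢ² = |G|` we find that `d²_max ≥ |G|/k` … Exponentiating
  both sides by `ω/2` gives `(|S||T||U|)^{ω/3} ≤ d_max^ω`. Since `d_max^ω ≤ ∑ᵢ dᵢ^ω` …"), from
  the tree's `sum_sq_charDegrees_holds` (`∑ χ(1)² = |G|`, `IrreducibleCharacters`) and
  `card_irrChars_le_card_conjClasses` (`#Irr(G) ≤ k`, `NumberOfIrreducibles`); as in print, the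
  triple-product hypothesis is not used.
* `BCCGU2017_thm42_holds` — **Thm. 4.2** with the explicit constants `c = 1/5`, `d = 3e⁷`
  (`BCCGU2017_thm42_log` is the logarithmic form
  `n/5 − 3e⁷ √n log n ≤ log n! − (2/3)(log|H₁| + log|H₂| + log|H₃|)`).
* `YoungSubgroupBarrier_holds` — the conjunction.

## The proof of Thm. 4.2 formalised here

It is NOT the printed "fairly delicate induction" on the largest part (BCCGU §4, three cases
`t > 0.9n`, `t < e^{0.49}√n`, middle, with Lemma 4.3); it is a direct argument using only the
pairwise-trivial-intersection hypothesis, with the ingredients of `YoungSubgroupCounting.lean`.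
Write `aᵢ(x)` for the size of the block of `x` in the `i`-th partition.
1. `log|Hᵢ| ≤ ∑_x log(aᵢ(x)!)/aᵢ(x) ≤ ∑_x (log aᵢ(x) − 1 + (1 + log aᵢ(x))/aᵢ(x))`
   (`log_card_youngSubgroup_le`, Stirling `log_factorial_div_le`).
2. Blocks of different partitions meet in at most one point, so `(x, y, z) ↦ (y, z)` is injective
   on `{y ∼ᵢ x, z ∼ⱼ x}`: `∑_x aᵢ(x)aⱼ(x) ≤ n²` (`sum_card_block_mul_le`).
3. Pointwise, for `log n ≥ 14`: `∑ᵢ costᵢ − (a₁a₂ + a₂a₃ + a₁a₃)/(2n) ≤ (3/2) log n − 33/10`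
   (`three_var_le`; the Lagrange multiplier `1/(2n)` is tuned to the configuration `aᵢ ≡ √n`,
   realised e.g. by the three parallel classes of lines of slopes `0, ∞, 1` in `𝔽_q²`, for which
   `n!/(|H₁||H₂||H₃|)^{2/3} = e^{n + O(√n log n)}` — so no `c > 1` is possible in Thm. 4.2; the
   printed proof does not make its constants explicit).
4. Summing 3 over `x` and using 2: `∑ᵢ log|Hᵢ| ≤ (3/2) n log n − (33/10) n + (3/2) n`, while
   `log n! ≥ n log n − n` (`sub_le_log_factorial`); hence
   `log n! − (2/3) ∑ᵢ log|Hᵢ| ≥ n/5`.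
5. For `log n < 14` the trivial bounds `|Hᵢ| ≤ n!`, `log n! ≤ n log n` and `√n < e⁷` give
   `log n! − (2/3)∑ᵢ log|Hᵢ| ≥ −n log n ≥ n/5 − 3e⁷ √n log n`.

## References

* J. Blasiak, T. Church, H. Cohn, J. A. Grochow, C. Umans, *Which groups are amenable to proving
  exponent two for matrix multiplication?*, arXiv:1712.02302v1 (2017), Prop. 2.4 (with proof),
  §4 Thm. 4.2 (`BlasiakChurchCohnGrochowUmans2017`; numbering of the arXiv version, text checked
  on the held copy `paper:arxiv-1712.02302`, pp. 4 and 9–10).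
* J.-P. Serre, *Linear Representations of Finite Groups* (1977), §2.4 Cor. 2, §2.5 Thm. 7
  (`SerreLinearRepresentations1977`), through the tree files cited above.
-/

noncomputable section

open Finset Real

namespace Literature.Barriers.MatrixMultiplication

open Literature.RepresentationTheory.FiniteGroups

/-! ### Thm. 4.2 -/

section Thm42

variable {n : ℕ}

/-- Step 1 of the proof of Thm. 4.2: `log|youngSubgroup f| ≤ ∑_x (log a(x) − 1 + (1 + log a(x))/a(x))`,
`a(x)` the size of the block of `x`. [cite: BlasiakChurchCohnGrochowUmans2017, Thm. 4.2] -/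
theorem log_card_youngSubgroup_le_sum_cost (f : Fin n → ℕ) :
    Real.log (Nat.card (youngSubgroup f)) ≤
      ∑ x, (Real.log ((univ.filter fun y => f y = f x).card : ℕ) - 1 +
        (1 + Real.log ((univ.filter fun y => f y = f x).card : ℕ)) /
          ((univ.filter fun y => f y = f x).card : ℕ)) :=
  (log_card_youngSubgroup_le f).trans
    (Finset.sum_le_sum fun x _ => log_factorial_div_le (one_le_card_block f x))

/-- Step 2 of the proof of Thm. 4.2, real form of `sum_card_block_mul_le`:
`∑_x a_f(x) a_g(x) ≤ n²`. [cite: BlasiakChurchCohnGrochowUmans2017, Thm. 4.2] -/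
theorem sum_card_block_mul_le_real {f g : Fin n → ℕ} (h : youngSubgroup f ⊓ youngSubgroup g = ⊥) :
    ∑ x, ((univ.filter fun y => f y = f x).card : ℝ) * ((univ.filter fun y => g y = g x).card : ℕ) ≤
      (n : ℝ) ^ 2 := by
  have := sum_card_block_mul_le h
  exact_mod_cast this

/-- Steps 3–4 of the proof of Thm. 4.2 (the analytic core, for abstract block-size functions
`a₁ a₂ a₃ : Fin n → ℕ`): if `log n ≥ 14`, `aᵢ ≥ 1`, `∑_x aᵢ(x)aⱼ(x) ≤ n²` for the three pairs, and
`Λᵢ ≤ ∑_x (log aᵢ(x) − 1 + (1 + log aᵢ(x))/aᵢ(x))`, then `Λ₁ + Λ₂ + Λ₃ ≤ (3/2) n log n − (9/5) n`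
(sum the pointwise inequality `three_var_le` over `x`). [cite: BlasiakChurchCohnGrochowUmans2017, Thm. 4.2] -/
theorem young_sum_log_le_of_costs (hn0 : (0 : ℝ) < n) (hn14 : 14 ≤ Real.log n) (a₁ a₂ a₃ : Fin n → ℕ)
    (h1 : ∀ x, 1 ≤ a₁ x) (h2 : ∀ x, 1 ≤ a₂ x) (h3 : ∀ x, 1 ≤ a₃ x)
    (h12 : ∑ x, (a₁ x : ℝ) * (a₂ x : ℕ) ≤ (n : ℝ) ^ 2)
    (h23 : ∑ x, (a₂ x : ℝ) * (a₃ x : ℕ) ≤ (n : ℝ) ^ 2)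
    (h13 : ∑ x, (a₁ x : ℝ) * (a₃ x : ℕ) ≤ (n : ℝ) ^ 2) {Λ₁ Λ₂ Λ₃ : ℝ}
    (hΛ₁ : Λ₁ ≤ ∑ x, (Real.log (a₁ x : ℕ) - 1 + (1 + Real.log (a₁ x : ℕ)) / (a₁ x : ℕ)))
    (hΛ₂ : Λ₂ ≤ ∑ x, (Real.log (a₂ x : ℕ) - 1 + (1 + Real.log (a₂ x : ℕ)) / (a₂ x : ℕ)))
    (hΛ₃ : Λ₃ ≤ ∑ x, (Real.log (a₃ x : ℕ) - 1 + (1 + Real.log (a₃ x : ℕ)) / (a₃ x : ℕ))) :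
    Λ₁ + Λ₂ + Λ₃ ≤ 3 / 2 * n * Real.log n - 9 / 5 * n := by
  -- the pointwise inequality `three_var_le`, penalties moved to the right
  have hpt : ∀ x, Real.log (a₁ x : ℕ) - 1 + (1 + Real.log (a₁ x : ℕ)) / (a₁ x : ℕ) +
      (Real.log (a₂ x : ℕ) - 1 + (1 + Real.log (a₂ x : ℕ)) / (a₂ x : ℕ)) +
      (Real.log (a₃ x : ℕ) - 1 + (1 + Real.log (a₃ x : ℕ)) / (a₃ x : ℕ)) ≤
      (3 / 2 * Real.log n - 33 / 10) + (a₁ x : ℝ) * (a₂ x : ℕ) / (2 * n) +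
        (a₂ x : ℝ) * (a₃ x : ℕ) / (2 * n) + (a₁ x : ℝ) * (a₃ x : ℕ) / (2 * n) := by
    intro x
    have h := three_var_le hn0 hn14 (by exact_mod_cast h1 x : (1 : ℝ) ≤ (a₁ x : ℕ))
      (by exact_mod_cast h2 x : (1 : ℝ) ≤ (a₂ x : ℕ)) (by exact_mod_cast h3 x : (1 : ℝ) ≤ (a₃ x : ℕ))
    have e : ((a₁ x : ℝ) * (a₂ x : ℕ) + (a₂ x : ℝ) * (a₃ x : ℕ) + (a₁ x : ℝ) * (a₃ x : ℕ)) / (2 * n) =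
        (a₁ x : ℝ) * (a₂ x : ℕ) / (2 * n) + (a₂ x : ℝ) * (a₃ x : ℕ) / (2 * n) +
          (a₁ x : ℝ) * (a₃ x : ℕ) / (2 * n) := by ring
    linarith
  have hsum := Finset.sum_le_sum fun x (_ : x ∈ (univ : Finset (Fin n))) => hpt x
  have hL : ∑ x, (Real.log (a₁ x : ℕ) - 1 + (1 + Real.log (a₁ x : ℕ)) / (a₁ x : ℕ) +
      (Real.log (a₂ x : ℕ) - 1 + (1 + Real.log (a₂ x : ℕ)) / (a₂ x : ℕ)) +
      (Real.log (a₃ x : ℕ) - 1 + (1 + Real.log (a₃ x : ℕ)) / (a₃ x : ℕ))) =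
      ∑ x, (Real.log (a₁ x : ℕ) - 1 + (1 + Real.log (a₁ x : ℕ)) / (a₁ x : ℕ)) +
      ∑ x, (Real.log (a₂ x : ℕ) - 1 + (1 + Real.log (a₂ x : ℕ)) / (a₂ x : ℕ)) +
      ∑ x, (Real.log (a₃ x : ℕ) - 1 + (1 + Real.log (a₃ x : ℕ)) / (a₃ x : ℕ)) := by
    rw [Finset.sum_add_distrib, Finset.sum_add_distrib]
  have hR : ∑ x, ((3 / 2 * Real.log n - 33 / 10) + (a₁ x : ℝ) * (a₂ x : ℕ) / (2 * n) +
        (a₂ x : ℝ) * (a₃ x : ℕ) / (2 * n) + (a₁ x : ℝ) * (a₃ x : ℕ) / (2 * n)) =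
      n * (3 / 2 * Real.log n - 33 / 10) + ∑ x, (a₁ x : ℝ) * (a₂ x : ℕ) / (2 * n) +
        ∑ x, (a₂ x : ℝ) * (a₃ x : ℕ) / (2 * n) + ∑ x, (a₁ x : ℝ) * (a₃ x : ℕ) / (2 * n) := by
    rw [Finset.sum_add_distrib, Finset.sum_add_distrib, Finset.sum_add_distrib, Finset.sum_const,
      Finset.card_univ, Fintype.card_fin, nsmul_eq_mul]
  rw [hL, hR] at hsum
  -- the penalties, summed (step 2)
  have hn2 : (0 : ℝ) < 2 * n := by linarith
  have hp12 : ∑ x, (a₁ x : ℝ) * (a₂ x : ℕ) / (2 * n) ≤ n / 2 := by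
    rw [← Finset.sum_div, div_le_iff₀ hn2]; nlinarith
  have hp23 : ∑ x, (a₂ x : ℝ) * (a₃ x : ℕ) / (2 * n) ≤ n / 2 := by
    rw [← Finset.sum_div, div_le_iff₀ hn2]; nlinarith
  have hp13 : ∑ x, (a₁ x : ℝ) * (a₃ x : ℕ) / (2 * n) ≤ n / 2 := by
    rw [← Finset.sum_div, div_le_iff₀ hn2]; nlinarith
  linarith

/-- **BCCGU Thm. 4.2, logarithmic form with explicit constants** `c = 1/5`, `d = 3e⁷`: for `n ≥ 2`
and three Young subgroups of `Sₙ` with pairwise trivial intersections,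
`n/5 − 3e⁷ √n log n ≤ log n! − (2/3)(log|H₁| + log|H₂| + log|H₃|)`.  Proof: steps 1–5 of the
module docstring (not the printed induction). [cite: BlasiakChurchCohnGrochowUmans2017, Thm. 4.2] -/
theorem BCCGU2017_thm42_log (hn : 2 ≤ n) (f₁ f₂ f₃ : Fin n → ℕ)
    (h12 : youngSubgroup f₁ ⊓ youngSubgroup f₂ = ⊥) (h23 : youngSubgroup f₂ ⊓ youngSubgroup f₃ = ⊥)
    (h13 : youngSubgroup f₁ ⊓ youngSubgroup f₃ = ⊥) :
    (1 / 5 : ℝ) * n - 3 * Real.exp 7 * Real.sqrt n * Real.log n ≤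
      Real.log (n.factorial) - 2 / 3 * (Real.log (Nat.card (youngSubgroup f₁)) +
        Real.log (Nat.card (youngSubgroup f₂)) + Real.log (Nat.card (youngSubgroup f₃))) := by
  have hn0 : (0 : ℝ) < n := by exact_mod_cast (by omega : 0 < n)
  have hn1 : (1 : ℝ) < n := by exact_mod_cast (by omega : 1 < n)
  have hlogn : 0 < Real.log n := Real.log_pos hn1
  have hsqrt : 0 ≤ Real.sqrt n := Real.sqrt_nonneg _
  have hfact := sub_le_log_factorial n
  have hd : 0 ≤ 3 * Real.exp 7 * Real.sqrt n * Real.log n := by positivity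
  by_cases h14 : 14 ≤ Real.log n
  · -- large `n`: steps 1–4
    have key := young_sum_log_le_of_costs hn0 h14 _ _ _ (one_le_card_block f₁) (one_le_card_block f₂)
      (one_le_card_block f₃) (sum_card_block_mul_le_real h12) (sum_card_block_mul_le_real h23)
      (sum_card_block_mul_le_real h13) (log_card_youngSubgroup_le_sum_cost f₁)
      (log_card_youngSubgroup_le_sum_cost f₂) (log_card_youngSubgroup_le_sum_cost f₃)
    linarith
  · -- small `n`: step 5
    push Not at h14
    have hΛ := add_le_add (add_le_add (log_card_youngSubgroup_le_log_factorial f₁)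
      (log_card_youngSubgroup_le_log_factorial f₂)) (log_card_youngSubgroup_le_log_factorial f₃)
    have hfu := log_factorial_le_mul_log n
    have hsq : Real.sqrt n < Real.exp 7 := by
      rw [Real.sqrt_lt' (Real.exp_pos 7), ← Real.exp_nat_mul]
      norm_num
      rwa [← Real.log_lt_iff_lt_exp hn0]
    have hl2 : (1 : ℝ) / 10 ≤ Real.log n := by
      have := Real.log_two_gt_d9
      have : Real.log 2 ≤ Real.log n := Real.log_le_log two_pos (by exact_mod_cast hn)
      linarith
    have hkey : 3 * (n : ℝ) * Real.log n ≤ 3 * Real.exp 7 * Real.sqrt n * Real.log n := by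
      have : (n : ℝ) ≤ Real.exp 7 * Real.sqrt n :=
        calc (n : ℝ) = Real.sqrt n * Real.sqrt n := (Real.mul_self_sqrt hn0.le).symm
          _ ≤ Real.exp 7 * Real.sqrt n := mul_le_mul_of_nonneg_right hsq.le hsqrt
      nlinarith
    nlinarith

/-- **Discharge of `BCCGU2017_thm42` (BCCGU 2017, Thm. 4.2)**: there are universal constants
`c, d > 0` (here `c = 1/5`, `d = 3e⁷`) such that for every `n ≥ 2` and all Young subgroups
`H₁, H₂, H₃ ≤ Sₙ` with pairwise trivial intersections,
`e^{cn − d√n log n} ≤ n!/(|H₁||H₂||H₃|)^{2/3}` ("There exists universal constants `c, d > 0` for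
which `|Sₙ|/(|H₁||H₂||H₃|)^{2/3} ≥ e^{cn − d√n log n}`"). From `BCCGU2017_thm42_log` by exponentiating.
[cite: BlasiakChurchCohnGrochowUmans2017, Thm. 4.2] -/
theorem BCCGU2017_thm42_holds : BCCGU2017_thm42 := by
  refine ⟨1 / 5, 3 * Real.exp 7, by norm_num, by positivity, fun n hn f₁ f₂ f₃ h12 h23 h13 => ?_⟩
  have h := BCCGU2017_thm42_log hn f₁ f₂ f₃ h12 h23 h13
  have c1 : 0 < Nat.card (youngSubgroup f₁) := Nat.card_pos
  have c2 : 0 < Nat.card (youngSubgroup f₂) := Nat.card_pos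
  have c3 : 0 < Nat.card (youngSubgroup f₃) := Nat.card_pos
  have hP : (0 : ℝ) < ((Nat.card (youngSubgroup f₁) * Nat.card (youngSubgroup f₂) *
      Nat.card (youngSubgroup f₃) : ℕ) : ℝ) := by
    exact_mod_cast Nat.mul_pos (Nat.mul_pos c1 c2) c3
  have hfac : (0 : ℝ) < n.factorial := by exact_mod_cast Nat.factorial_pos n
  rw [Real.rpow_def_of_pos hP, ← Real.exp_log hfac, ← Real.exp_sub, Real.exp_le_exp]
  have hlog : Real.log ((Nat.card (youngSubgroup f₁) * Nat.card (youngSubgroup f₂) *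
      Nat.card (youngSubgroup f₃) : ℕ) : ℝ) = Real.log (Nat.card (youngSubgroup f₁)) +
        Real.log (Nat.card (youngSubgroup f₂)) + Real.log (Nat.card (youngSubgroup f₃)) := by
    push_cast
    rw [Real.log_mul (by positivity) (by positivity), Real.log_mul (by positivity) (by positivity)]
  rw [hlog]
  linarith

end Thm42

/-! ### Prop. 2.4 -/

section Prop24

/-- **Discharge of `BCCGU2017_prop24` (BCCGU 2017, Prop. 2.4, the conjugacy-class criterion)**,
proved as printed: with `k = #` conjugacy classes `≥ #Irr(G)` (`card_irrChars_le_card_conjClasses`)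
and `∑_χ χ(1)² = |G|` (`sum_sq_charDegrees_holds`), the largest degree satisfies
`k d_max² ≥ |G| ≥ k (|S||T||U|)^{2/3}`, so `(|S||T||U|)^{1/3} ≤ d_max` and
`(|S||T||U|)^{w/3} ≤ d_max^w ≤ ∑_χ χ(1)^w = charDegreePowSum G w` for every `w > 0`.  The
triple-product hypothesis is not used (as in print). [cite: BlasiakChurchCohnGrochowUmans2017, Prop. 2.4] -/
theorem BCCGU2017_prop24_holds : BCCGU2017_prop24 := by
  intro G _ _ S T U _hTPP hk w hw
  classical
  generalize S.card * T.card * U.card = P at hk ⊢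
  have hfin := irrChars_finite_holds G
  set F := hfin.toFinset with hFdef
  have hre : ∀ χ ∈ F, χ 1 = (((χ 1).re : ℝ) : ℂ) ∧ 0 ≤ (χ 1).re := by
    intro χ hχ
    obtain ⟨d, _, hd⟩ := (hfin.mem_toFinset.mp hχ).exists_apply_one
    rw [hd]
    simp
  have hsq : ∑ χ ∈ F, (χ 1).re ^ 2 = (Fintype.card G : ℝ) := by
    have h := sum_sq_charDegrees_holds G
    rw [finsum_mem_eq_finite_toFinset_sum _ hfin] at h
    have h' : ∑ χ ∈ F, χ 1 ^ 2 = ((∑ χ ∈ F, (χ 1).re ^ 2 : ℝ) : ℂ) := by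
      push_cast
      exact Finset.sum_congr rfl fun χ hχ => by rw [← (hre χ hχ).1]
    rw [h', Nat.card_eq_fintype_card] at h
    exact_mod_cast h
  have hFne : F.Nonempty := ⟨_, hfin.mem_toFinset.mpr character_trivial_mem_irrChars⟩
  obtain ⟨χ₀, hχ₀, hmax⟩ := F.exists_max_image (fun χ => (χ 1).re) hFne
  have hD0 : 0 ≤ (χ₀ 1).re := (hre χ₀ hχ₀).2
  have hcardF : (F.card : ℝ) ≤ Nat.card (ConjClasses G) := by
    exact_mod_cast card_irrChars_le_card_conjClasses
  have h1 : (Fintype.card G : ℝ) ≤ Nat.card (ConjClasses G) * (χ₀ 1).re ^ 2 := by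
    rw [← hsq]
    calc ∑ χ ∈ F, (χ 1).re ^ 2 ≤ ∑ χ ∈ F, (χ₀ 1).re ^ 2 :=
          Finset.sum_le_sum fun χ hχ => pow_le_pow_left₀ (hre χ hχ).2 (hmax χ hχ) 2
      _ = F.card * (χ₀ 1).re ^ 2 := by rw [Finset.sum_const, nsmul_eq_mul]
      _ ≤ Nat.card (ConjClasses G) * (χ₀ 1).re ^ 2 :=
          mul_le_mul_of_nonneg_right hcardF (sq_nonneg _)
  have hkpos : (0 : ℝ) < Nat.card (ConjClasses G) := by exact_mod_cast Nat.card_pos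
  have h2 : (P : ℝ) ^ (2 / 3 : ℝ) ≤ (χ₀ 1).re ^ 2 := le_of_mul_le_mul_left (hk.trans h1) hkpos
  have hP0 : (0 : ℝ) ≤ P := by positivity
  have h3 : (P : ℝ) ^ (1 / 3 : ℝ) ≤ (χ₀ 1).re := by
    have e : ((P : ℝ) ^ (1 / 3 : ℝ)) ^ 2 = (P : ℝ) ^ (2 / 3 : ℝ) := by
      rw [← Real.rpow_natCast, ← Real.rpow_mul hP0]; norm_num
    rw [← e] at h2
    exact (pow_le_pow_iff_left₀ (by positivity) hD0 two_ne_zero).1 h2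
  have h4 : (P : ℝ) ^ (w / 3) = ((P : ℝ) ^ (1 / 3 : ℝ)) ^ w := by
    rw [← Real.rpow_mul hP0]; congr 1; ring
  rw [h4]
  calc ((P : ℝ) ^ (1 / 3 : ℝ)) ^ w ≤ (χ₀ 1).re ^ w := Real.rpow_le_rpow (by positivity) h3 hw.le
    _ ≤ charDegreePowSum G w := by
        unfold charDegreePowSum
        rw [finsum_mem_eq_finite_toFinset_sum _ hfin]
        exact Finset.single_le_sum (f := fun χ => (χ 1).re ^ w)
          (fun χ hχ => Real.rpow_nonneg (hre χ hχ).2 w) hχ₀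

end Prop24

/-! ### The catalogue entry -/

section Barrier

/-- **Discharge of the catalogue entry `YoungSubgroupBarrier`** (BCCGU 2017, Prop. 2.4 ∧ Thm. 4.2):
both conjuncts are theorems (`BCCGU2017_prop24_holds`, `BCCGU2017_thm42_holds`), so the barrier —
three Young subgroups of `Sₙ` with the triple product property prove nothing about `ω` once `Sₙ`
has at most `e^{cn − d√n log n}` conjugacy classes (`YoungSubgroupBarrier.no_nontrivial_bound`) —
holds unconditionally. [cite: BlasiakChurchCohnGrochowUmans2017, Prop. 2.4 and Thm. 4.2] -/
theorem YoungSubgroupBarrier_holds : YoungSubgroupBarrier :=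
  ⟨BCCGU2017_prop24_holds, BCCGU2017_thm42_holds⟩

/-- The barrier's conclusion, now unconditional: with `c = 1/5`, `d = 3e⁷` (or any constants of
Thm. 4.2), for every `n ≥ 2` such that `Sₙ` has at most `e^{cn − d√n log n}` conjugacy classes,
every Young TPP triple satisfies the Cohn–Umans inequality for all `w > 0`.
[cite: BlasiakChurchCohnGrochowUmans2017, Thm. 4.2 and Prop. 2.4] -/
theorem young_no_nontrivial_bound_holds :
    ∃ c d : ℝ, 0 < c ∧ 0 < d ∧ ∀ n : ℕ, 2 ≤ n →
      (Nat.card (ConjClasses (Equiv.Perm (Fin n))) : ℝ) ≤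
          Real.exp (c * n - d * Real.sqrt n * Real.log n) →
      ∀ (f₁ f₂ f₃ : Fin n → ℕ),
        Literature.Combinatorics.Additive.TripleProductProperty
          (Finset.univ.filter (· ∈ youngSubgroup f₁))
          (Finset.univ.filter (· ∈ youngSubgroup f₂))
          (Finset.univ.filter (· ∈ youngSubgroup f₃)) →
        ∀ w : ℝ, 0 < w →
          (((Finset.univ.filter (· ∈ youngSubgroup f₁)).card *
              (Finset.univ.filter (· ∈ youngSubgroup f₂)).card *
              (Finset.univ.filter (· ∈ youngSubgroup f₃)).card : ℕ) : ℝ) ^ (w / 3) ≤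
            charDegreePowSum (Equiv.Perm (Fin n)) w :=
  YoungSubgroupBarrier_holds.no_nontrivial_bound

end Barrier

end Literature.Barriers.MatrixMultiplication

end
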